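import Summits.HodgeConjecture.HodgeConjecture.Theorems.VHCAbelianSchemesRoadSecantQuotientAnchorPinnedDefs
import HarnessLib

/-!
# Road №4 (`VHCAbelianSchemesRoad`) — TWO `Prop`-NODES ON THE PINNED SERVED SET AT A DATUM'S OWN CHART: the own-chart anchor clauses
# (P1) and WEIL-PLANE RIGIDITY of the pinned served set (P2) — the residue of child (c3)
# `stub_secondCarriedOfOffDiagonalVanishingPrime_of_T_GRR` of crux stmt-HodgeConjecture-26512 (skeleton v3.9 f1912d6f699b48a2)

research route conditional on HC_CM; not a corollary; Q11.4-sentence-2 already refuted in dim ≥ 3.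

DEFINITIONS ONLY (ring2-b03x gen 14, the ONE bounded prover seat of director-hodge g14 R14.14 on child (c3); `HC_CM` nowhere; nothing
asserted). WHY THESE NODES EXIST. The (c3) target `SecondCarriedOfOffDiagonalVanishingPrime C` (p618714 §5) concludes, at a datum `D` with
pin `h_Y(θ₀)`, that EVERY class of the pinned served set `𝔖^pin(D.Y.X, h_Y(θ₀)) = secantQuotientServedClassesPinned D.Y.X (D.hY θ₀)` lies in
`ℂγ₁ + ℂγ₂ + ℂh_Y(θ₀)³`. But membership `γ ∈ 𝔖^pin(X, θ)` (`IsSecantQuotientWeilClassAtPinned X θ γ`, p510628's road file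
`…SecantQuotientAnchorPinnedDefs`) is EXISTENTIAL IN THE PRESENTATION: SOME datum `D'`, SOME chart `e : X ≅ D'.Y.X` and SOME pin `θ₀'` with
`e⁻¹^*θ = h_{Y'}(θ₀')`, the ample-line and hyperbolicity clauses holding FOR `D'`, and `q'^*(e⁻¹^*γ)` in the Weil plane OF `D'`. At the
datum's own chart `(D.Y.X, h_Y(θ₀))` nothing in the tree says that a served class is served THROUGH `D` itself: neither that `D`'s own
descended polarisation satisfies the ample-line ∕ hyperbolicity clauses (print-level: Markman §1.5, Cor. 3.2.3, Lemma 3.1.3 — typed in the tree only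
AT PRINT'S OWN DATUM, from the pinned claim, `exists_secantQuotientDatum_compatibleClauses_of_pinned`), nor that `q^*γ` lies in `D`'s Weil
plane `weilClassesOf D.P D.ψ 3 D.d` when `γ` is served through another presentation `(D', e, θ₀')`. THEOREM T and GRR (children (c1), (c2)) speak
about push-forwards of one object along one isogeny of `D.Y`; they are silent about classes served through other presentations. Hence (c3) as
registered is NOT derivable from T′ ∧ GRR without an input of the following kind, and (c3)'s own conclusion implies the rigidity modulo `ℂh³`
at every datum in its domain (it puts `𝔖^pin` inside a 3-space) — so the input is NECESSARY IN KIND, not an artefact of one proof: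

* (P1) `SecantQuotientPinnedOwnChartClauses` — **at a datum whose own pinned chart is a pinned anchor, the datum's OWN presentation has the
  anchor clauses**: `h_Y(θ₀)` is on the line of an ample divisor of `Y` and `(J × Ĵ, φ_d)` is hyperbolic for `q^*h_Y(θ₀) = Ξ_d(θ₀)`. PRINT-LEVEL
  (descent of the polarisation `Ξ_d` along `q`, `Ḡ` isotropic — Markman §1.5 p. 7, Cor. 3.2.3; hyperbolicity of `(X × X̂, η, Ξ)` — Lemma 3.1.3 ∕
  §3.1, van Geemen 5.4); in the tree only at print's datum. Size S–M each once the descent of polarisations along isogenies with isotropic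
  kernel (Mumford §23) is typed; a HYPOTHESIS wherever used.
* (P2) `SecantQuotientPinnedWeilPlaneRigidity` — **WEIL-PLANE RIGIDITY OF THE PINNED SERVED SET**: every class pinned-served at `(D.Y.X, h_Y(θ₀))`
  — through WHATEVER presentation — pulls back under `D`'s own `q` into `D`'s own Weil plane. IN-HOUSE, NOT IN PRINT. Why it should hold: a
  second presentation `(D', e, θ₀')` of the polarised sixfold `(Y_d, h_Y)` transports `K' = ℚ(φ_{d'}) ↪ End⁰(Y)`; the polarisation type of `h_Y`
  fixes `d' = d`, and for `End J = ℤ` (`End⁰(Y) = M₂(ℚ)`) the similitude group of the binary norm form `x² + dy²` is `K^× ⋊ ⟨σ⟩`, whose elements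
  commute or anti-commute with `φ_d`, so `e^*` carries `W(D')` onto `W(D)` (the Weil plane is symmetric under `φ_d ↦ −φ_d`). WHY IT MIGHT FAIL: at
  data with `End⁰(J) ≠ ℚ` (CM Jacobians, extra automorphisms) a presentation `(D', e)` with `e^*φ_{d}'` NOT in `±`(the `K`-line of `φ_d`) would
  serve rational classes off `W(D)` (none is known: the shape of `Ḡ = {(x₁ − x₂, φ_Θ(x₁ + x₂))}` constrains `e`); the node is then false AT SUCH
  DATA and the line must restrict the anchor family (as it already does to H-good non-hyperelliptic presentations) or re-key `𝔖^pin` to the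
  presenting datum. A HYPOTHESIS wherever used; refuter target.

With (P1) ∧ (P2), `𝔖^pin(D.Y.X, h_Y(θ₀))` IS the punctured rational Weil plane of `D` read on `Y` (`IsSecantQuotientWeilClassAtPinned.of_refl_of_ne_zero`
gives `⊇`, (P2) gives `⊆`), and (c3) becomes a kernel theorem of T′ ∧ GRR (companion file `…SecondCarriedOfTGRR`). Unfolding lemmas `_iff` only.

NOT CLAIMED: (P1), (P2), any stub, 2m′ᵒᴴ, 26512, 26511, 23176, `HC_AV`, `HC_CM` or HC; HC_CM HELD, by name only; typed ≠ proved.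
References: [cite: Markman2025SecantWeil, §1.3 (p. 5), §1.5 (p. 7), Thm. 1.4.1 (item 4), §3.1 Lemma 3.1.3, §3.2 Cor. 3.2.3 and §9.3 Lemma 9.3.11]
[cite: vanGeemen1994HodgeAV, 4.9, Lemma 5.2 and 5.4] [cite: MumfordAV1970, §23 (descent of polarisations) and §19]
[cite: MoonenZarhin1998WeilClasses, §1 (dim_K W_K = 1)] [cite: Deligne1982HodgeCycles, §4 (4.3)–Prop. 4.4].
-/

noncomputable section

open CategoryTheory CategoryTheory.Limits AlgebraicGeometry Topology

namespace Summit.HodgeConjecture.HodgeConjecture.Ring2.SemiregularRepresentatives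

set_option linter.dupNamespace false -- the cell's namespace repeats the summit name, as in every `Ring2*` file

open Literature.AlgebraicGeometry Literature.AlgebraicGeometry.Motives Literature.AlgebraicGeometry.Motives.AbelianVariety
open Literature.AlgebraicGeometry.HodgeTheory Literature.AlgebraicGeometry.Markman2025
open Literature.AlgebraicTopology.SingularHomology

/-- **(P1) THE OWN-CHART ANCHOR CLAUSES** (`SecantQuotientPinnedOwnChartClauses`): for every secant–quotient datum `D` and every polarisation
class `θ₀` of `Θ` such that the datum's own pinned chart `(D.Y.X, h_Y(θ₀))` is a pinned anchor (some class is pinned-served there, through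
some presentation), the two `Y`-side anchor clauses of `IsSecantQuotientWeilClassAtPinned` hold FOR `D` ITSELF: `h_Y(θ₀)` is on the line of an
ample Cartier divisor of `Y = (J × Ĵ)/Ḡ` (the polarisation `Ξ_d(θ₀) = p₁^*θ₀ + d·p₂^*θ̂₀` descends along `q`, `Ḡ` being isotropic), and
`(J × Ĵ, φ_d)` is of hyperbolic Weil type for `q^*h_Y(θ₀) = Ξ_d(θ₀)`. PRINT-LEVEL (Markman §1.5 p. 7 «the polarised abelian variety
`(Y_d, h)`», Cor. 3.2.3, §3.1 ∕ Lemma 3.1.3), typed in the tree only at print's own datum (`exists_secantQuotientDatum_compatibleClauses_of_pinned`,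
from the pinned claim); exactly the hypotheses `hamp`, `hW` of `IsSecantQuotientWeilClassAtPinned.of_refl`. A HYPOTHESIS wherever used.
[cite: Markman2025SecantWeil, §1.5 (p. 7), §3.1 Lemma 3.1.3 and §3.2 Cor. 3.2.3] [cite: MumfordAV1970, §23] [cite: vanGeemen1994HodgeAV, 5.4] -/
@[conjecture] def SecantQuotientPinnedOwnChartClauses : Prop :=
  ∀ (D : SecantQuotientDatum) (θ₀ : complexBetti D.𝒥.J.X 2), D.𝒥.J.IsPolarizationClassOf D.Θ θ₀ →
    secantQuotientAnchorsPinned D.Y.X (D.hY θ₀) →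
      (∃ H : CartierDivisor D.Y.X.left, H.IsAmple ∧ D.Y.IsPolarizationClassOf H (D.hY θ₀)) ∧
        IsHyperbolicWeilType D.P D.ψ 3 (complexBetti.map D.q.hom.hom.hom 2 (D.hY θ₀))

/-- (P1) unfolded (definitional). [cite: Markman2025SecantWeil, §1.5 (p. 7) and §3.2 Cor. 3.2.3] -/
theorem secantQuotientPinnedOwnChartClauses_iff :
    SecantQuotientPinnedOwnChartClauses ↔
      ∀ (D : SecantQuotientDatum) (θ₀ : complexBetti D.𝒥.J.X 2), D.𝒥.J.IsPolarizationClassOf D.Θ θ₀ →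
        secantQuotientAnchorsPinned D.Y.X (D.hY θ₀) →
          (∃ H : CartierDivisor D.Y.X.left, H.IsAmple ∧ D.Y.IsPolarizationClassOf H (D.hY θ₀)) ∧
            IsHyperbolicWeilType D.P D.ψ 3 (complexBetti.map D.q.hom.hom.hom 2 (D.hY θ₀)) :=
  Iff.rfl

/-- **(P2) WEIL-PLANE RIGIDITY OF THE PINNED SERVED SET** (`SecantQuotientPinnedWeilPlaneRigidity`): for every secant–quotient datum `D` and
every polarisation class `θ₀` of `Θ`, every class `γ` pinned-served at the datum's own pinned chart `(D.Y.X, h_Y(θ₀))` — through WHATEVER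
presentation `(D', e, θ₀')` — has `q^*γ` in `D`'s OWN Weil plane `weilClassesOf D.P D.ψ 3 D.d` («the Weil plane of the polarised sixfold
`(Y_d, h_Y)` does not depend on the presentation»; `dim W = 2`, Moonen–Zarhin). IN-HOUSE, not in print; automatic for `End J = ℤ` (similitudes of
`x² + dy²` are `K^× ⋊ ⟨σ⟩`); OPEN at data with extra endomorphisms (module docstring: why it might fail). Converse direction of
`IsSecantQuotientWeilClassAtPinned.of_refl`; with (P1) it makes `𝔖^pin(D.Y.X, h_Y(θ₀))` the punctured rational Weil plane of `D`. The residue of child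
(c3) of crux stmt-HodgeConjecture-26512 (its conclusion implies this modulo `ℂh_Y(θ₀)³` wherever it applies). A HYPOTHESIS wherever used; refuter target.
[cite: Markman2025SecantWeil, Thm. 1.4.1 (item 4), §1.3 (p. 5) and §1.5 (p. 7)] [cite: MoonenZarhin1998WeilClasses, §1]
[cite: vanGeemen1994HodgeAV, 4.9 and Lemma 5.2] [cite: Deligne1982HodgeCycles, §4 (4.3)–Prop. 4.4] -/
@[conjecture] def SecantQuotientPinnedWeilPlaneRigidity : Prop :=
  ∀ (D : SecantQuotientDatum) (θ₀ : complexBetti D.𝒥.J.X 2), D.𝒥.J.IsPolarizationClassOf D.Θ θ₀ →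
    ∀ γ ∈ secantQuotientServedClassesPinned D.Y.X (D.hY θ₀),
      complexBetti.map D.q.hom.hom.hom (2 * 3) γ ∈ weilClassesOf D.P D.ψ 3 D.d

/-- (P2) unfolded (definitional). [cite: Markman2025SecantWeil, Thm. 1.4.1 (item 4)] -/
theorem secantQuotientPinnedWeilPlaneRigidity_iff :
    SecantQuotientPinnedWeilPlaneRigidity ↔
      ∀ (D : SecantQuotientDatum) (θ₀ : complexBetti D.𝒥.J.X 2), D.𝒥.J.IsPolarizationClassOf D.Θ θ₀ →
        ∀ γ ∈ secantQuotientServedClassesPinned D.Y.X (D.hY θ₀),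
          complexBetti.map D.q.hom.hom.hom (2 * 3) γ ∈ weilClassesOf D.P D.ψ 3 D.d :=
  Iff.rfl

end Summit.HodgeConjecture.HodgeConjecture.Ring2.SemiregularRepresentatives

end
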